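import Summits.ABC.IUTFork.ForkInflation
import Summits.ABC.IUTFork.LDHCor312
import HarnessLib

/-!
# The fork at [IUTchIII] Corollary 3.12, L-DH level (c312-3), II-b: the SKELETON's Cor-3.12 nouns
# CONSTRUCTED from Dupuy–Hilado data — `ForkRegions`/`ForkInflation` made concrete

Record-only file (D-0012) of the abc-iut cell (seat abc-iut-c312-3; `plan/LDH-SPEC.md` D8/D9, TRANCHE-T1
P10); TAKES NO SIDE. The skeleton types Cor. 3.12 one level below the reals as an INTERFACE:
`ForkRegions.VolumeContainer` (carrier `𝕃`, admissible regions, monotone `ln ν̄`, hull),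
`Cor312Setting` (possible images `U_λ` of the Θ-pilot object, image `Q` of the `q`-pilot object),
`ForkInflation.PilotCalibration` (bare Θ-region with `ln ν̄ = −deĝ_lgp(P_Θ)` and `−|log q| = −deĝ(P_q)` as
POSITED fields, over the Literature pilot data `PilotData F`), `IndData`. This file BUILDS the first three
from the Dupuy–Hilado data `DHData` of `LDHCor312` (pilot data, packet model with indeterminacy transports,
ideles, (Ind3)-datum, hull admissibility). NORMALISATION: the skeleton's calibration uses the un-normalised
Arakelov degrees `deĝ` (`LgpDivisor.degLgp`, `FinDivisor.deg`), Dupuy–Hilado's `ln ν̄_𝕃` is `[F:ℚ]`-normalised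
(it computes `deĝ̲ = deĝ/[F:ℚ]`, Thm. 3.10.1); the container's log-volume is therefore `[F:ℚ]·ln ν̄_𝕃` — a
positive rescaling, under which `Cor312` is unchanged (`cor312_iff_cor312DH`):

* `DHData.toVolumeContainer`/`toSetting : Cor312Setting` — carrier `𝕃 = ⊔ summands` (regions = subsets read
  summandwise, DH Rmk. 3.5.2), `ln ν̄ = [F:ℚ]·ln ν̄_𝕃` (Def. 3.6.3, rescaled as above), hull = summandwise hull
  (§4.12), possible images `U_{(g,σ)} = g·σ·(O_𝕃(−P_Θ))^{Ind3}` (§4.11), `Q = O_𝕃(−P_q)`;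
* `DHData.toCalibration : PilotCalibration D.toSetting D.X` whose two posited identities are THEOREMS (DH
  Thm. 3.10.1 via `LDHCor312.lnνL_regionΘ/q`);
* `cor312_iff_cor312DH` — the skeleton's `Cor312` of the constructed setting IS Dupuy–Hilado's (1.1)
  (`LDHCor312.DHData.Cor312DH`); `outputRegions_cor312_iff` (the `ForkLana` shadow too); `estimate_iff`
  (the skeleton's `Estimate δ` is `LDHCor312.EstimateDH (δ/[F:ℚ])`); hence every `ForkInflation` calibration theorem
  holds for this setting with the real pilot degrees (e.g. `deg_qPilot_le_of_squeeze_skel`);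
* `representedVol_iff` — Reading 1 of `ForkRegions` (`RepresentedVol`, = LANA (9-1) of the carried
  η-setting) holds iff `ln ν̄_𝕃((O_𝕃(−P_Θ))^{Ind3}) = −deĝ̲(P_q)`: the skeleton's
  `IndData.representedVol_iff_of_preserving` with its modelling hypothesis ("Ind1, Ind2 preserve `ln ν̄`")
  supplied by `MultiradialRegion.lnνL_UTheta`, i.e. REDUCED to the summand-level fields `logμ_perm`
  (modelling) / `logμ_smul` (DH §4.9 fn) of the packet model — not proved here.

The skeleton's `IndData` itself is not instantiated: its (Ind1) slot is an abstract group acting on the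
carrier, while Dupuy–Hilado's (Ind1) transports the summand `v⃗∘σ` onto the summand `v⃗`; the possible images
are indexed DIRECTLY by `Ind2Elt × Ind1Elt`, and `IndData`'s theorems are re-proved for this indexing
(`free_inequality_skel`, `logvol_U`, `representedVol_iff`). [cite: DupuyHilado2025, §1 (1.1), §3.9,
Thm. 3.10.1, §4.10–4.12] [cite: LANA2026Report, §8.3 p. 43] [claim: Mochizuki2012, status: disputed]
Deliberately NOT here: whether [IUTchIII] Thm. 3.11 licenses (1.1); any judgement.
-/

noncomputable section

open Set Finset

namespace Summit.ABC.IUTFork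

open Literature.IUT.LogVolume NumberField IsDedekindDomain
open scoped Pointwise

variable {F : Type} [Field F] [NumberField F]

namespace DHData

open RegionEncoding

variable (D : DHData F)

/-- The volume container of the data: `𝕃 = ⊔ summands`, admissible = summandwise admissible,
`ln ν̄ := [F:ℚ]·ln ν̄_𝕃` over `T` (Def. 3.6.3; rescaled to the skeleton's un-normalised degrees), hull =
summandwise hull (§4.12) — monotonicity of `ln ν̄` PROVED (`lnνL_mono`). [cite: DupuyHilado2025, Def. 3.6.3, §4.12] -/
def toVolumeContainer : VolumeContainer where
  L := Carrier D.M.toPacketModel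
  Adm A := D.M.RegionAdm (ofSet D.M.toPacketModel A)
  logvol A := (Module.finrank ℚ F : ℝ) * D.M.lnνL D.X.lstar D.T (ofSet D.M.toPacketModel A)
  logvol_mono := by
    intro A B hA hB hAB
    exact mul_le_mul_of_nonneg_left (D.M.lnνL_mono _ _ hA hB (ofSet_mono _ hAB))
      (FinDivisor.finrank_pos (F := F)).le
  hull := ClosureOperator.mk'
    (fun A => toSet D.M.toPacketModel (D.M.hull (ofSet D.M.toPacketModel A)))
    (fun A A' h => toSet_mono _ fun p j e => D.M.hull.monotone (ofSet_mono _ h) p j e)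
    (fun A => by
      intro x hx
      exact D.M.le_hull (ofSet D.M.toPacketModel A) x.1.1 x.1.2.1 x.1.2.2 hx)
    (fun A => by
      show toSet _ (D.M.hull (ofSet _ (toSet _ (D.M.hull (ofSet D.M.toPacketModel A))))) ⊆ _
      rw [ofSet_toSet, D.M.hull.idempotent])

/-- **The Cor-3.12 setting of the data** (`ForkRegions.Cor312Setting`, CONSTRUCTED): possible images
`U_{(g,σ)} := g·σ·(O_𝕃(−P_Θ))^{Ind3}` (§4.11), `Q := O_𝕃(−P_q)`. [cite: DupuyHilado2025, §4.11] -/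
def toSetting : Cor312Setting where
  toVolumeContainer := D.toVolumeContainer
  Idx := D.M.Ind2Elt × D.M.Ind1Elt
  U lam := toSet D.M.toPacketModel (D.M.UTheta D.ind3 lam)
  U_adm lam := D.M.UTheta_adm D.ind3 lam
  Uhol_adm := by
    show D.M.RegionAdm (ofSet _ (toSet _ (D.M.hull (ofSet _ (⋃ lam, toSet _ (D.M.UTheta D.ind3 lam))))))
    rw [ofSet_toSet]
    have h : ofSet D.M.toPacketModel (⋃ lam, toSet D.M.toPacketModel (D.M.UTheta D.ind3 lam)) =
        D.M.UThetaUnion D.ind3 := by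
      funext p j e
      rw [ofSet_iUnion]
      rfl
    rw [h]
    exact D.hull_adm
  Q := toSet D.M.toPacketModel (D.M.region D.tq)
  Q_adm := D.M.region_adm D.tq

/-- The union of the possible images, read summandwise, is `U_Θ`. [cite: DupuyHilado2025, §4.11] -/
theorem ofSet_iUnion_U :
    ofSet D.M.toPacketModel (⋃ lam, D.toSetting.U lam) = D.M.UThetaUnion D.ind3 := by
  funext p j e
  ext y
  simp only [ofSet, Set.mem_setOf_eq, Set.mem_iUnion, IndPacketModel.UThetaUnion]
  exact exists_congr fun _ => Iff.rfl

/-- `−|log(Θ)|` of the setting is `[F:ℚ]·ln ν̄_𝕃(hull(U_Θ))`. [cite: DupuyHilado2025, §1 p. 4] -/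
theorem negLogTheta_eq : D.toSetting.negLogTheta = (Module.finrank ℚ F : ℝ) * D.negLogThetaDH := by
  show (Module.finrank ℚ F : ℝ) *
      D.M.lnνL D.X.lstar D.T (ofSet _ (toSet _ (D.M.hull (ofSet _ (⋃ lam, D.toSetting.U lam))))) = _
  rw [ofSet_toSet, ofSet_iUnion_U]
  rfl

/-- `−|log(q)|` of the setting is `[F:ℚ]·ln ν̄_𝕃(O_𝕃(−P_q))`. [cite: DupuyHilado2025, §3.9] -/
theorem negAbsLogq_eq' : D.toSetting.negAbsLogq = (Module.finrank ℚ F : ℝ) * D.negAbsLogqDH := rfl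

/-- **The pilot calibration of the constructed setting** (`ForkInflation.PilotCalibration D.toSetting D.X`),
with BOTH posited identities now THEOREMS: bare region `O_𝕃(−P_Θ)`, `[F:ℚ]·ln ν̄_𝕃(O_𝕃(−P_Θ)) = −deĝ_lgp(P_Θ)`,
`−|log q| = [F:ℚ]·ln ν̄_𝕃(O_𝕃(−P_q)) = −deĝ(P_q)` (DH Thm. 3.10.1, `LDHCor312.lnνL_regionΘ/q`).
[cite: DupuyHilado2025, Thm. 3.10.1] -/
def toCalibration : PilotCalibration D.toSetting D.X where
  bare := toSet D.M.toPacketModel (D.M.region D.tΘ)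
  bare_adm := D.M.region_adm D.tΘ
  logvol_bare := by
    have hF : (Module.finrank ℚ F : ℝ) ≠ 0 := (FinDivisor.finrank_pos (F := F)).ne'
    show (Module.finrank ℚ F : ℝ) * D.M.lnνL D.X.lstar D.T (ofSet _ (toSet _ (D.M.region D.tΘ))) = _
    rw [ofSet_toSet, lnνL_regionΘ, LgpDivisor.ndegLgp_eq]
    field_simp
  negAbsLogq_eq := by
    have hF : (Module.finrank ℚ F : ℝ) ≠ 0 := (FinDivisor.finrank_pos (F := F)).ne'
    rw [negAbsLogq_eq', negAbsLogqDH, lnνL_regionq, FinDivisor.ndeg_apply]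
    field_simp

/-- **The skeleton's `Cor312` of the constructed setting is (1.1)** (`LDHCor312.DHData.Cor312DH`).
[cite: DupuyHilado2025, §1 (1.1)] -/
theorem cor312_iff_cor312DH : D.toSetting.Cor312 ↔ D.Cor312DH := by
  have hF := FinDivisor.finrank_pos (F := F)
  rw [Cor312Setting.Cor312, negLogTheta_eq, negAbsLogq_eq', cor312DH_iff_logvol]
  exact ⟨fun h => le_of_mul_le_mul_left h hF, fun h => mul_le_mul_of_nonneg_left h hF.le⟩

/-- Hence the real-number shadow too: `D.toSetting.toOutputRegions.Cor312 ↔ (1.1)` (`ForkLana.OutputRegions`).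
[cite: DupuyHilado2025, §1 (1.1)] -/
theorem outputRegions_cor312_iff : D.toSetting.toOutputRegions.Cor312 ↔ D.Cor312DH := by
  rw [Cor312Setting.toOutputRegions_cor312_iff, cor312_iff_cor312DH]

/-- The skeleton's `Estimate δ` of the constructed calibration is `EstimateDH (δ/[F:ℚ])` (rescaling).
[claim: Mochizuki2012, status: disputed] -/
theorem estimate_iff (δ : ℝ) : D.toCalibration.Estimate δ ↔ D.EstimateDH (δ / Module.finrank ℚ F) := by
  have hF := FinDivisor.finrank_pos (F := F)
  rw [PilotCalibration.Estimate, negLogTheta_eq, EstimateDH]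
  show (Module.finrank ℚ F : ℝ) * D.negLogThetaDH ≤
      (Module.finrank ℚ F : ℝ) * D.M.lnνL D.X.lstar D.T (ofSet _ (toSet _ (D.M.region D.tΘ))) + δ ↔ _
  rw [ofSet_toSet]
  have e : (Module.finrank ℚ F : ℝ) * (D.M.lnνL D.X.lstar D.T (D.M.region D.tΘ) + δ / Module.finrank ℚ F) =
      (Module.finrank ℚ F : ℝ) * D.M.lnνL D.X.lstar D.T (D.M.region D.tΘ) + δ := by
    have hF' : (Module.finrank ℚ F : ℝ) ≠ 0 := hF.ne'
    field_simp
  constructor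
  · intro h
    rw [← e] at h
    exact le_of_mul_le_mul_left h hF
  · intro h
    rw [← e]
    exact mul_le_mul_of_nonneg_left h hF.le

/-- The skeleton's free inequality for this setting (`ForkInflation.PilotCalibration.free_inequality`; = the
core file's `free_inequality` through the bridge). [cite: DupuyHilado2025, §4.10–4.12] -/
theorem free_inequality_skel : -LgpDivisor.degLgp D.X.thetaPilot ≤ D.toSetting.negLogTheta := by
  refine D.toCalibration.free_inequality ⟨((fun _ _ _ => 1), (fun _ => 1)), ?_⟩
  exact toSet_mono _ (D.M.region_subset_UTheta_one D.ind3)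

/-- Every possible image has ONE log-volume, that of `(O_𝕃(−P_Θ))^{Ind3}`.
[cite: DupuyHilado2025, §4.7, §4.9, §4.11] -/
theorem logvol_U (lam : D.toSetting.Idx) :
    D.toSetting.logvol (D.toSetting.U lam) = (Module.finrank ℚ F : ℝ) * D.M.lnνL D.X.lstar D.T D.ind3.bare3 := by
  show (Module.finrank ℚ F : ℝ) * D.M.lnνL D.X.lstar D.T (ofSet _ (toSet _ (D.M.UTheta D.ind3 lam))) = _
  rw [ofSet_toSet, D.M.lnνL_UTheta]

/-- **LANA's volume-level reading pins on (Ind3)**: Reading 1 of `ForkRegions` (`RepresentedVol`: some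
possible image has the log-volume of the `q`-pilot image; = (9-1) of the carried η-setting) holds for this
data iff `ln ν̄_𝕃((O_𝕃(−P_Θ))^{Ind3}) = −deĝ̲(P_q)` — the skeleton's `IndData.representedVol_iff_of_preserving`
with its modelling hypothesis supplied by `MultiradialRegion.lnνL_UTheta` (reduced to the packet model's
summand-level fields, not proved here). [cite: LANA2026Report, §8.3 p. 43] -/
theorem representedVol_iff :
    D.toSetting.RepresentedVol ↔ D.M.lnνL D.X.lstar D.T D.ind3.bare3 = -FinDivisor.ndeg F D.X.qPilot := by
  have hF := (FinDivisor.finrank_pos (F := F)).ne'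
  rw [Cor312Setting.RepresentedVol, negAbsLogq_eq', negAbsLogqDH, lnνL_regionq]
  constructor
  · rintro ⟨lam, h⟩
    rw [logvol_U] at h
    exact mul_left_cancel₀ hF h
  · intro h
    exact ⟨((fun _ _ _ => 1), (fun _ => 1)), by rw [logvol_U, h]⟩

/-- In particular Reading 1 requires the (Ind3)-enlargement ALONE to inflate `O_𝕃(−P_Θ)` by exactly the gap:
`ln ν̄((O_𝕃(−P_Θ))^{Ind3}) − ln ν̄(O_𝕃(−P_Θ)) = deĝ̲_lgp(P_Θ) − deĝ̲(P_q)`. [claim: Mochizuki2012, status: disputed] -/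
theorem representedVol_iff_ind3_gap :
    D.toSetting.RepresentedVol ↔
      D.M.lnνL D.X.lstar D.T D.ind3.bare3 - D.M.lnνL D.X.lstar D.T (D.M.region D.tΘ) =
        LgpDivisor.ndegLgp D.X.thetaPilot - FinDivisor.ndeg F D.X.qPilot := by
  rw [representedVol_iff, lnνL_regionΘ]
  constructor <;> intro h <;> linarith

/-- The skeleton's squeeze for this setting (`ForkInflation.PilotCalibration.deg_qPilot_le_of_squeeze`): (1.1)
and the skeleton's estimate with discrepancy `δ` give `deĝ(P_q) ≤ δ/(w̄ − 1)`, `w̄ = avgWeightAt sqWeights ℓ⋇`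
(un-normalised degree; divide by `[F:ℚ]` for the core file's `ndeg_qPilot_le_of_squeeze`).
[claim: Mochizuki2012, status: disputed] -/
theorem deg_qPilot_le_of_squeeze_skel {δ : ℝ} (h1 : D.Cor312DH) (h2 : D.toCalibration.Estimate δ) :
    FinDivisor.deg F D.X.qPilot ≤ δ / (avgWeightAt sqWeights D.X.lstar - 1) :=
  D.toCalibration.deg_qPilot_le_of_squeeze ((cor312_iff_cor312DH D).mpr h1) h2

end DHData

end Summit.ABC.IUTFork

end
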